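import Literature.NumberTheory.IwasawaTheory.ClassicalLambdaLeStableRank
import HarnessLib

/-!
# Fukuda's growth step with a FIXED submodule: `#Y_k ≤ #Y_{k+1} · #(M/(pM + C))` for `Y_k = (φ^{p^k} − 1)M`, `φ = 1` on `C` — the algebra behind
# «`λ = (eventual p-rank) − 1` when the Iwasawa module has a cyclic finite submodule fixed by `Γ`» (proved; no definition, no named fact)

Topic `NumberTheory/IwasawaTheory` (namespace = path, sub-namespace `FukudaNakayama`).  THEOREM-ONLY file, written by the prover seat `bsd-line-att-p3` g32
(cell `bsd-f1-sign2`; `--supports` stmt-BirchSwinnertonDyer-22298; closes nothing).  Companion of `FukudaGrowthAlgebra.lean` / `ClassicalLambdaLeStableRank.lean`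
(there: `e_{n+k+1} ≤ e_{n+k} + r` with `r` the `p`-rank of the top layer).  Needed for the UPPER half `λ₂ ≤ Σ − 1` of Ferrero's / Kida's formula in the `2`-ramified case
(`ImaginaryQuadraticTwoTowerGenusRankEven.lean` proves `Σ − 1 ≤ λ₂ ≤ Σ`): there the top class group carries the Galois-FIXED dyadic class `c` of order `2`, eventually
outside `2·Cl`, so `#(M/(2M + ℤc)) = #(M/2M)/2`.

THE STATEMENT.  `M` a finite abelian `p`-group, `φ ∈ End(M)` with `φ^{p^t} = 1`, `#(M/pM) ≤ p^r`, `r ≤ p^{k₀}`, `k ≥ k₀ + 1`; `C ≤ M` a submodule on which `φ` is the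
identity; `Y_k := (φ^{p^k} − 1)M` (a `LinearMap.range`).  ★ `card_range_pow_sub_one_le_mul` — **`#Y_k ≤ #Y_{k+1} · #(M/(pM + C))`**.  In a `ℤ_p`-tower with one totally
ramified prime, `#A_{n+k} = #A_{n+t}/#Y_k` (exact control), so this reads `e_{n+k+1} − e_{n+k} ≤ log_p #(M/(pM + C))`, i.e. `≤ r − 1` when `C = ℤc`, `c ∉ pM`.
PROOF.  Unipotence (tree `sub_one_apply_mem_map_of_card_le`, `sub_one_apply_mem_map_map_of`, `pow_sub_one_apply_mem`) gives `(ψ − 1)Y_k ⊆ p²Y_k` for `ψ = φ^{p^k}`, so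
`Y_{k+1} = (1 + ψ + ⋯ + ψ^{p−1})Y_k = pY_k` (`map_geom_sum_eq_map_smul`); then `#Y_k = #(pY_k)·#(Y_k/pY_k)` and `m ↦ (ψ−1)m` induces `M/(pM + C) ↠ Y_k/pY_k`.

References: [Fukuda1994] Thm. 1 (2), p. 264 (proof); [Washington1997] §13.3 Lemma 13.18, Prop. 13.23 (proof), Prop. 13.28; [Ferrero1980AJM] §3; [Kida1979Tohoku] Thm. 1.
-/

set_option autoImplicit false

noncomputable section

open Finset

namespace Literature.NumberTheory.IwasawaTheory.FukudaNakayama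

variable {M : Type*} [AddCommGroup M] [Finite M]

omit [Finite M] in
/-- A `φ`-stable submodule is stable under `φ^n`. [folklore] -/
private theorem pow_apply_mem' (φ : Module.End ℤ M) (W : Submodule ℤ M) (hW : ∀ w ∈ W, φ w ∈ W) (n : ℕ) {w : M} (hw : w ∈ W) : (φ ^ n) w ∈ W := by
  induction n generalizing w with
  | zero => simpa using hw
  | succ n ih => rw [pow_succ, Module.End.mul_apply]; exact ih (hW w hw)

omit [Finite M] in
/-- `range (φ^m − 1)` is `φ`-stable (`φ` commutes with `φ^m − 1`). [folklore] -/
private theorem apply_mem_range_pow_sub_one (φ : Module.End ℤ M) (m : ℕ) {w : M} (hw : w ∈ LinearMap.range (φ ^ m - 1)) :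
    φ w ∈ LinearMap.range (φ ^ m - 1) := by
  obtain ⟨x, rfl⟩ := LinearMap.mem_range.mp hw
  refine LinearMap.mem_range.mpr ⟨φ x, ?_⟩
  have hcomm : (φ ^ m - 1) * φ = φ * (φ ^ m - 1) := by
    rw [sub_mul, mul_sub, one_mul, mul_one, ← pow_succ, ← pow_succ']
  have := congrArg (fun f : Module.End ℤ M => f x) hcomm
  simpa [Module.End.mul_apply] using this

omit [Finite M] in
/-- `φ = 1` on `C` implies `φ^n = 1` on `C`. [folklore] -/
private theorem pow_apply_eq_self_of_forall (φ : Module.End ℤ M) (C : Submodule ℤ M) (hC : ∀ c ∈ C, φ c = c) (n : ℕ) {c : M} (hc : c ∈ C) : (φ ^ n) c = c := by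
  induction n with
  | zero => simp
  | succ n ih => rw [pow_succ, Module.End.mul_apply, hC c hc, ih]

/-- ★ **Fukuda's growth step with a fixed submodule: `#Y_k ≤ #Y_{k+1} · #(M/(pM + C))`**, `Y_k = (φ^{p^k} − 1)M`, for a finite abelian `p`-group `M`, `φ^{p^t} = 1`,
`#(M/pM) ≤ p^r`, `r ≤ p^{k₀}`, `k ≥ k₀ + 1`, and `φ = 1` on `C` (module docstring). [cite: Fukuda1994, Thm. 1 (2), p. 264 (proof)]
[cite: Washington1997, §13.3 Lemma 13.18 and Prop. 13.23 (proof)] -/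
theorem card_range_pow_sub_one_le_mul {p : ℕ} [hp : Fact p.Prime] (hM : ∃ a : ℕ, Nat.card M = p ^ a) (φ : Module.End ℤ M) {t : ℕ} (hφ : φ ^ (p ^ t) = 1)
    {r k₀ k : ℕ} (hr : Nat.card (M ⧸ LinearMap.range ((p : ℤ) • (1 : Module.End ℤ M))) ≤ p ^ r) (hk₀ : r ≤ p ^ k₀) (hk : k₀ + 1 ≤ k)
    (C : Submodule ℤ M) (hC : ∀ c ∈ C, φ c = c) :
    Nat.card (LinearMap.range (φ ^ (p ^ k) - 1)) ≤
      Nat.card (LinearMap.range (φ ^ (p ^ (k + 1)) - 1)) * Nat.card (M ⧸ (LinearMap.range ((p : ℤ) • (1 : Module.End ℤ M)) ⊔ C)) := by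
  classical
  set π : Module.End ℤ M := (p : ℤ) • (1 : Module.End ℤ M) with hπ
  have hπapp : ∀ x, π x = (p : ℤ) • x := fun x => by rw [hπ, LinearMap.smul_apply, Module.End.one_apply]
  set ψ : Module.End ℤ M := φ ^ (p ^ k) with hψ
  set W : Submodule ℤ M := LinearMap.range (ψ - 1) with hW
  have hWstab : ∀ w ∈ W, φ w ∈ W := fun w hw => apply_mem_range_pow_sub_one φ (p ^ k) hw
  -- ### unipotence: `(φ^{p^{k₀}} − 1)W ⊆ pW`, `(φ^{p^k} − 1)W ⊆ p²W`
  have hu₀ : ∀ w ∈ W, (φ ^ (p ^ k₀) - 1) w ∈ W.map π := sub_one_apply_mem_map_of_card_le hM φ hφ hr hk₀ W hWstab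
  have hu₁ : ∀ w ∈ W, (φ ^ (p ^ (k₀ + 1)) - 1) w ∈ (W.map π).map π := sub_one_apply_mem_map_map_of φ W hWstab hu₀
  have huk : ∀ w ∈ W, (ψ - 1) w ∈ (W.map π).map π := by
    obtain ⟨d, hd⟩ := Nat.exists_eq_add_of_le hk
    have hpow : ψ = (φ ^ (p ^ (k₀ + 1))) ^ (p ^ d) := by rw [hψ, ← pow_mul, ← pow_add, hd]
    rw [hpow]
    exact pow_sub_one_apply_mem _ W _ (fun y hy => pow_apply_mem' φ W hWstab _ hy) hu₁ _
  -- ### `Y_{k+1} = (1 + ψ + ⋯ + ψ^{p−1})Y_k = pY_k`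
  have hΦ : W.map (∑ i ∈ range p, ψ ^ i) = W.map π :=
    map_geom_sum_eq_map_smul hM ψ W (fun y hy => pow_apply_mem' φ W hWstab _ hy) huk
  have hYk1 : LinearMap.range (φ ^ (p ^ (k + 1)) - 1) = W.map π := by
    have hid : φ ^ (p ^ (k + 1)) - 1 = (∑ i ∈ range p, ψ ^ i) * (ψ - 1) := by
      rw [geom_sum_mul, hψ, ← pow_mul, ← pow_succ]
    rw [hid, Module.End.mul_eq_comp, LinearMap.range_comp, ← hW, hΦ]
  -- ### `#W = #(pW) · #(W/pW)`
  set πW : Module.End ℤ W := (p : ℤ) • (1 : Module.End ℤ W) with hπW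
  have h1 := Submodule.card_eq_card_quotient_mul_card (LinearMap.range πW)
  have h2 : Nat.card (LinearMap.range πW) = Nat.card (W.map π) := by
    let f : LinearMap.range πW → W.map π := fun x => ⟨((x : W) : M), by
      obtain ⟨w, hw⟩ := LinearMap.mem_range.mp x.2
      refine Submodule.mem_map.mpr ⟨(w : M), w.2, ?_⟩
      have := congrArg (fun y : W => (y : M)) hw
      simpa [hπW, hπ] using this⟩
    have hf : Function.Bijective f := by
      constructor
      · intro x y h
        apply Subtype.ext; apply Subtype.ext
        exact congrArg (fun z : W.map π => (z : M)) h
      · rintro ⟨y, hy⟩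
        obtain ⟨w, hw, rfl⟩ := Submodule.mem_map.mp hy
        refine ⟨⟨πW ⟨w, hw⟩, LinearMap.mem_range_self _ _⟩, Subtype.ext ?_⟩
        simp [f, hπW, hπ]
    exact Nat.card_eq_of_bijective f hf
  -- ### `M/(pM + C) ↠ W/pW` via `m ↦ (ψ − 1)m`
  have h3 : Nat.card (W ⧸ LinearMap.range πW) ≤ Nat.card (M ⧸ (LinearMap.range π ⊔ C)) := by
    set g : M →ₗ[ℤ] W ⧸ LinearMap.range πW := (LinearMap.range πW).mkQ ∘ₗ (ψ - 1).rangeRestrict with hg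
    have hgsurj : Function.Surjective g := by
      rw [hg, LinearMap.coe_comp]
      exact (Submodule.mkQ_surjective _).comp (LinearMap.surjective_rangeRestrict _)
    have hker : LinearMap.range π ⊔ C ≤ LinearMap.ker g := by
      refine sup_le ?_ ?_
      · rintro _ ⟨m, rfl⟩
        rw [LinearMap.mem_ker, hg, LinearMap.comp_apply]
        refine (Submodule.Quotient.mk_eq_zero _).mpr (LinearMap.mem_range.mpr ⟨(ψ - 1).rangeRestrict m, Subtype.ext ?_⟩)
        simp only [hπW, LinearMap.smul_apply, Module.End.one_apply, Submodule.coe_smul, LinearMap.codRestrict_apply, hπapp, map_zsmul]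
      · intro c hc
        rw [LinearMap.mem_ker, hg, LinearMap.comp_apply]
        have h0 : (ψ - 1).rangeRestrict c = 0 := by
          apply Subtype.ext
          simp only [LinearMap.codRestrict_apply, LinearMap.sub_apply, Module.End.one_apply, Submodule.coe_zero, hψ]
          rw [pow_apply_eq_self_of_forall φ C hC _ hc, sub_self]
        rw [h0, map_zero]
    have hsurj' : Function.Surjective ((LinearMap.range π ⊔ C).liftQ g hker) := by
      rintro y
      obtain ⟨m, rfl⟩ := hgsurj y
      exact ⟨Submodule.Quotient.mk m, rfl⟩
    haveI : Finite (M ⧸ (LinearMap.range π ⊔ C)) := Finite.of_surjective _ (Submodule.mkQ_surjective _)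
    exact Nat.card_le_card_of_surjective _ hsurj'
  -- ### combine
  rw [hYk1, ← h2]
  calc Nat.card W = Nat.card (LinearMap.range πW) * Nat.card (W ⧸ LinearMap.range πW) := h1
    _ ≤ Nat.card (LinearMap.range πW) * Nat.card (M ⧸ (LinearMap.range π ⊔ C)) := Nat.mul_le_mul_left _ h3

/-- **`#(M/(pM + ℤc)) · p ≤ #(M/pM)` for `c ∉ pM`** in a finite abelian `p`-group: `M/pM ↠ M/(pM + ℤc)` has a non-trivial kernel of `p`-power order. [folklore]
[cite: Washington1997, §13.3 (proof of Prop. 13.23)] -/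
theorem card_quotient_sup_span_mul_le {p : ℕ} [hp : Fact p.Prime] (hM : ∃ a : ℕ, Nat.card M = p ^ a) (c : M)
    (hc : c ∉ LinearMap.range ((p : ℤ) • (1 : Module.End ℤ M))) :
    Nat.card (M ⧸ (LinearMap.range ((p : ℤ) • (1 : Module.End ℤ M)) ⊔ Submodule.span ℤ {c})) * p ≤
      Nat.card (M ⧸ LinearMap.range ((p : ℤ) • (1 : Module.End ℤ M))) := by
  classical
  set P : Submodule ℤ M := LinearMap.range ((p : ℤ) • (1 : Module.End ℤ M)) with hP
  set Q : Submodule ℤ M := P ⊔ Submodule.span ℤ {c} with hQ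
  have hPQ : P ≤ Q := le_sup_left
  -- `M/P ↠ M/Q` with kernel `K`; `#(M/P) = #(M/Q)·#K`
  set f : M ⧸ P →ₗ[ℤ] M ⧸ Q := Submodule.mapQ P Q LinearMap.id hPQ with hf
  have hfsurj : Function.Surjective f := by
    rintro ⟨x⟩; exact ⟨Submodule.Quotient.mk x, rfl⟩
  have hcard : Nat.card (M ⧸ P) = Nat.card (LinearMap.ker f) * Nat.card (M ⧸ Q) := by
    rw [Submodule.card_eq_card_quotient_mul_card (LinearMap.ker f), Nat.card_congr (f.quotKerEquivOfSurjective hfsurj).toEquiv]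
  -- the kernel is non-trivial: it contains the class of `c`
  haveI : Finite (M ⧸ P) := Finite.of_surjective _ (Submodule.mkQ_surjective _)
  haveI : Finite (LinearMap.ker f) := Finite.of_injective _ Subtype.coe_injective
  have hK1 : 1 < Nat.card (LinearMap.ker f) := by
    rw [Finite.one_lt_card_iff_nontrivial]
    refine ⟨⟨⟨Submodule.Quotient.mk c, ?_⟩, 0, ?_⟩⟩
    · rw [LinearMap.mem_ker, hf]
      exact (Submodule.Quotient.mk_eq_zero Q).mpr (Submodule.mem_sup_right (Submodule.mem_span_singleton_self c))
    · intro h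
      have h' : (Submodule.Quotient.mk c : M ⧸ P) = 0 := congrArg Subtype.val h
      rw [Submodule.Quotient.mk_eq_zero] at h'
      exact hc h'
  -- and of `p`-power order
  obtain ⟨a, ha⟩ := hM
  have hdvdM : Nat.card (M ⧸ P) ∣ p ^ a := by
    rw [← ha, Submodule.card_eq_card_quotient_mul_card P]
    exact dvd_mul_left _ _
  have hdvdK : Nat.card (LinearMap.ker f) ∣ p ^ a := by
    refine dvd_trans ?_ hdvdM
    rw [hcard]; exact dvd_mul_right _ _
  obtain ⟨i, -, hi⟩ := (Nat.dvd_prime_pow hp.out).mp hdvdK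
  have hi1 : 1 ≤ i := by
    by_contra h0
    have : i = 0 := by omega
    rw [this, pow_zero] at hi
    omega
  rw [hcard, hi, mul_comm]
  exact Nat.mul_le_mul_right _ (by
    calc p = p ^ 1 := (pow_one p).symm
      _ ≤ p ^ i := Nat.pow_le_pow_right hp.out.pos hi1)

end Literature.NumberTheory.IwasawaTheory.FukudaNakayama

end
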